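import Summits.NavierStokesRegularity.NavierStokesRegularity.Theorems.ScenarioCensusRowF1Pincer
import Summits.NavierStokesRegularity.NavierStokesRegularity.Theorems.ScenarioCensusRowF1SocketReadout
import HarnessLib

/-!
# LINE 25 «eulerian-pincer» port, part 3/4: §8 THE EULERIAN PINCER — the numbers `ebbIntegrand` / `flareIntegrand`, the rows `Row_F1ie` (sub-self-similar side) / `Row_F1if`
# (super-self-similar side), the floors `DivergentEbbExcess` / `DivergentFlareDeficit`, the residual `PincerSlack` (≡ `Row_F1`), the dictionary

Re-homed for the scenario census (typer seat ns-census-typer-1 g9; the cells F1ie / F1if and the floors DE / DF are MEMBERS OF RECORD «DECIDED IN KERNEL IN FILES» of row F1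
since census v1.77 (critic backstop idea-crit-7 PASS 03:14Z; ref ns-census-ref g10 PRE-CHECK ✓ §15.17 item 41; lead-presearch label); this port makes them TREE-decided):
VERBATIM PORT of the NEW declarations (§1 read-outs, §6 kill, §8 rows) of ns-idea-3 LINE 25 «eulerian-pincer»,
`pub/ideators/ns-idea-3/lines/eulerian-pincer/line-eulerian-pincer.lean` sha16 b2a1952cbeded9c7 (1972 l., lean check rc 0, 0 sorry; the frame of §1, §2–§5 and §7 are
shared VERBATIM with LINES 18/20/22/24/27 and taken BY NAME from the landed ports — not re-declared), split for the 400-line rule into `ScenarioCensusRowF1Pincer` (§1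
read-outs) → `…PincerKill` (§6) → `…PincerRows` (§8 numbers/rows) → `…PincerTop` (§8 verdicts + census KEYS).  Lean text VERBATIM in namespace
`…Theorems.ScenarioCensus.EulerianPincer` (the line's `…Cruxes.ScenarioCensusRowF1.EulerianPincerLine` re-homed), shared names spelled by namespace (`LiouvilleSocket.…`
frame / τ-tool, `FrozenTop.…`, `InviscidTop.…`, `IntegratedStretch.…`, …); port edits: the bracket lines `section …` / `end …` dropped (no `variable`s), `@[conjecture]`
on the residual `PincerSlack` (≡ `ScenarioCensus.Row_F1`, OPEN), one-line docstrings added where missing (gate lint).  Statements untouched.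

No census VALUE is moved here (row F1 stays OPEN-WITH-LINE; the members become TREE-decided by name); NS regularity is NOT proved; `Row_F1` is untouched (zero
movement, `pincerSlack_iff_rowF1`); no summit statement is proved by this file.
-/

-- the summit and its single problem share the name `NavierStokesRegularity` (D-0017 nested layout)
set_option linter.dupNamespace false

noncomputable section

open MeasureTheory Set Function Filter TopologicalSpace Metric
open scoped Topology NNReal ENNReal InnerProductSpace RealInnerProductSpace Laplacian

namespace Summit.NavierStokesRegularity.NavierStokesRegularity.Theorems.ScenarioCensus.EulerianPincer

open Literature.Analysis Literature.Analysis.FluidPDE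
open Summit.NavierStokesRegularity.NavierStokesRegularity.Theorems

/-! ## §8 THE EULERIAN PINCER (NEW): the numbers, the rows `F1ie` (sub-self-similar side) and `F1if` (super-self-similar
side), both EXCLUDED; their floors; the residual ≡ `Row_F1`; the sign row «EBBING TOP» and the eventual threshold rows as
corollaries in kernel -/

/-- The number of the sub-side — the **EULERIAN EBB-EXCESS INTEGRAND OF THE FAST FLUID** on `[t₀, T)`:
`𝟙{t ∈ [t₀,T), Λ(t) < |u(t,x)|} · √(T − t) · max(0, ⟪ω, ∂ₜω⟫ − θ |ω|²/(T − t))`, `ω = curl u`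
(`⟪ω, ∂ₜω⟫ = ½ ∂ₜ|ω|²`: HALF THE EULERIAN — fixed-point — RATE of the enstrophy density; charged only in EXCESS of the
fraction `θ` of the self-similar rate `|ω|²/(T − t)`; ONE-SIDED; DYNAMIC but pressure-free: a time series of the scalar
`|ω|²` at fixed points suffices; `∂ₜ` within `[0, T)`, `vorticity u t = curl (u t)`). -/
def ebbIntegrand (T θ t₀ : ℝ) (Λ : ℝ → ℝ) (u : ℝ → LiouvilleSocket.E3 → LiouvilleSocket.E3) : ℝ × LiouvilleSocket.E3 → ℝ≥0∞ :=
  {z : ℝ × LiouvilleSocket.E3 | z.1 ∈ Ico t₀ T ∧ Λ z.1 < ‖u z.1 z.2‖}.indicator fun z =>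
    ENNReal.ofReal (Real.sqrt (T - z.1) *
      max 0 (⟪curl (u z.1) z.2, timeDerivWithin (Ico 0 T) (vorticity u) z.1 z.2⟫
        - θ * ((T - z.1)⁻¹ * ‖curl (u z.1) z.2‖ ^ 2)))

/-- The number of the super-side — the **EULERIAN FLARE-DEFICIT INTEGRAND OF THE FAST FLUID** on `[t₀, T)`:
`𝟙{t ∈ [t₀,T), Λ(t) < |u(t,x)|} · √(T − t) · max(0, κ |ω|²/(T − t) − ⟪ω, ∂ₜω⟫)` — the DEFICIT of the fixed-point rate
below the fraction `κ` of the self-similar rate. -/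
def flareIntegrand (T κ t₀ : ℝ) (Λ : ℝ → ℝ) (u : ℝ → LiouvilleSocket.E3 → LiouvilleSocket.E3) : ℝ × LiouvilleSocket.E3 → ℝ≥0∞ :=
  {z : ℝ × LiouvilleSocket.E3 | z.1 ∈ Ico t₀ T ∧ Λ z.1 < ‖u z.1 z.2‖}.indicator fun z =>
    ENNReal.ofReal (Real.sqrt (T - z.1) *
      max 0 (κ * ((T - z.1)⁻¹ * ‖curl (u z.1) z.2‖ ^ 2)
        - ⟪curl (u z.1) z.2, timeDerivWithin (Ico 0 T) (vorticity u) z.1 z.2⟫))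

/-- **Criterion row F1ie** (the exact frame of `Row_F1` plus ONE hypothesis: for some `θ < 1`, some `t₀ ∈ [0, T)` and
some MEASURABLE subcritical level, the Eulerian ebb-excess of the fast fluid is integrable against `√(T − t)` on
`[t₀, T) × ℝ³`).  PROVED (`rowF1ie_holds`). -/
def Row_F1ie : Prop :=
  ∀ (ν T : ℝ), 0 < ν → 0 < T → ∀ (u : ℝ → LiouvilleSocket.E3 → LiouvilleSocket.E3) (p : ℝ → LiouvilleSocket.E3 → ℝ),
    IsClassicalNSSolutionOn (Ico 0 T) ν 0 u p → IsLerayHopfOn T ν 0 (u 0) u →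
    HasRapidSpatialDecay (u 0) → IsTypeIBlowup u T →
    (∃ (θ t₀ : ℝ) (Λ : ℝ → ℝ), θ < 1 ∧ 0 ≤ t₀ ∧ t₀ < T ∧ LiouvilleSocket.IsSubcriticalLevel T Λ ∧ Measurable Λ ∧
      ∫⁻ z, ebbIntegrand T θ t₀ Λ u z < ⊤) →
    HasSmoothExtensionPast ν 0 u T

/-- **Criterion row F1if** (the frame of `Row_F1` plus: for some `κ > 1`, `t₀ ∈ [0, T)` and some measurable subcritical
level, the Eulerian flare-deficit of the fast fluid is integrable against `√(T − t)` on `[t₀, T) × ℝ³`).  PROVED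
(`rowF1if_holds`). -/
def Row_F1if : Prop :=
  ∀ (ν T : ℝ), 0 < ν → 0 < T → ∀ (u : ℝ → LiouvilleSocket.E3 → LiouvilleSocket.E3) (p : ℝ → LiouvilleSocket.E3 → ℝ),
    IsClassicalNSSolutionOn (Ico 0 T) ν 0 u p → IsLerayHopfOn T ν 0 (u 0) u →
    HasRapidSpatialDecay (u 0) → IsTypeIBlowup u T →
    (∃ (κ t₀ : ℝ) (Λ : ℝ → ℝ), 1 < κ ∧ 0 ≤ t₀ ∧ t₀ < T ∧ LiouvilleSocket.IsSubcriticalLevel T Λ ∧ Measurable Λ ∧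
      ∫⁻ z, flareIntegrand T κ t₀ Λ u z < ⊤) →
    HasSmoothExtensionPast ν 0 u T

/-- **DIVERGENT EBB-EXCESS** (structural floor, maximal frame, sub-side of the pincer): for a maximal Type-I Clay blow-up,
EVERY `θ < 1`, every `t₀ ∈ [0, T)` and every measurable subcritical level,
`∬_{[t₀,T), |u| > Λ(t)} √(T − t) [½∂ₜ|ω|² − θ|ω|²/(T − t)]₊ dx dt = ∞`.  PROVED (`divergentEbbExcess_holds`). -/
def DivergentEbbExcess : Prop :=
  ∀ (ν T : ℝ), 0 < ν → 0 < T → ∀ (u : ℝ → LiouvilleSocket.E3 → LiouvilleSocket.E3) (p : ℝ → LiouvilleSocket.E3 → ℝ),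
    IsMaximalSmoothSolution ν 0 u p T → IsLerayHopfOn T ν 0 (u 0) u →
    HasRapidSpatialDecay (u 0) → IsTypeIBlowup u T →
    ∀ θ : ℝ, θ < 1 → ∀ t₀ : ℝ, 0 ≤ t₀ → t₀ < T →
    ∀ Λ : ℝ → ℝ, LiouvilleSocket.IsSubcriticalLevel T Λ → Measurable Λ → ∫⁻ z, ebbIntegrand T θ t₀ Λ u z = ⊤

/-- **DIVERGENT FLARE-DEFICIT** (structural floor, maximal frame, super-side of the pincer): for a maximal Type-I Clay
blow-up, EVERY `κ > 1`, every `t₀ ∈ [0, T)` and every measurable subcritical level,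
`∬_{[t₀,T), |u| > Λ(t)} √(T − t) [κ|ω|²/(T − t) − ½∂ₜ|ω|²]₊ dx dt = ∞`.  PROVED (`divergentFlareDeficit_holds`). -/
def DivergentFlareDeficit : Prop :=
  ∀ (ν T : ℝ), 0 < ν → 0 < T → ∀ (u : ℝ → LiouvilleSocket.E3 → LiouvilleSocket.E3) (p : ℝ → LiouvilleSocket.E3 → ℝ),
    IsMaximalSmoothSolution ν 0 u p T → IsLerayHopfOn T ν 0 (u 0) u →
    HasRapidSpatialDecay (u 0) → IsTypeIBlowup u T →
    ∀ κ : ℝ, 1 < κ → ∀ t₀ : ℝ, 0 ≤ t₀ → t₀ < T →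
    ∀ Λ : ℝ → ℝ, LiouvilleSocket.IsSubcriticalLevel T Λ → Measurable Λ → ∫⁻ z, flareIntegrand T κ t₀ Λ u z = ⊤

/-- **Residual** (maximal frame): every maximal Type-I Clay blow-up ESCAPES THE PINCER on one side — for some `θ < 1` an
integrable ebb-excess, or for some `κ > 1` an integrable flare-deficit, at some `t₀ ∈ [0,T)` and some measurable
subcritical level.  DECLARED ≡ row F1 (`pincerSlack_iff_rowF1`); no movement on `Row_F1` is claimed. -/
@[conjecture] def PincerSlack : Prop :=
  ∀ (ν T : ℝ), 0 < ν → 0 < T → ∀ (u : ℝ → LiouvilleSocket.E3 → LiouvilleSocket.E3) (p : ℝ → LiouvilleSocket.E3 → ℝ),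
    IsMaximalSmoothSolution ν 0 u p T → IsLerayHopfOn T ν 0 (u 0) u →
    HasRapidSpatialDecay (u 0) → IsTypeIBlowup u T →
    (∃ (θ t₀ : ℝ) (Λ : ℝ → ℝ), θ < 1 ∧ 0 ≤ t₀ ∧ t₀ < T ∧ LiouvilleSocket.IsSubcriticalLevel T Λ ∧ Measurable Λ ∧
      ∫⁻ z, ebbIntegrand T θ t₀ Λ u z < ⊤) ∨
    (∃ (κ t₀ : ℝ) (Λ : ℝ → ℝ), 1 < κ ∧ 0 ≤ t₀ ∧ t₀ < T ∧ LiouvilleSocket.IsSubcriticalLevel T Λ ∧ Measurable Λ ∧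
      ∫⁻ z, flareIntegrand T κ t₀ Λ u z < ⊤)

/-- **The split**: the two criterion rows + the residual ⇒ row F1 (by cases on extendability and on the side). -/
theorem rowF1_of (hE : Row_F1ie) (hF : Row_F1if) (hR : PincerSlack) : ScenarioCensus.Row_F1 := by
  unfold ScenarioCensus.Row_F1
  intro ν T hν hT u p hsol hLH hdec hTI
  by_contra hext
  rcases hR ν T hν hT u p ⟨hsol, hext⟩ hLH hdec hTI with h | h
  · exact hext (hE ν T hν hT u p hsol hLH hdec hTI h)
  · exact hext (hF ν T hν hT u p hsol hLH hdec hTI h)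

/-- Row F1 ⇒ the residual (vacuously: no maximal Type-I Clay blow-up). -/
theorem pincerSlack_of_rowF1 (h : ScenarioCensus.Row_F1) : PincerSlack :=
  fun ν T hν hT u p hmax hLH hdec hTI => (hmax.2 (h ν T hν hT u p hmax.1 hLH hdec hTI)).elim

/-! ### Dictionary: the numbers = `ν^{5/2} ×` the normalised `[t₀,T)`-top integrands of `ebbOf θ` / `flareOf κ`
(kinematics + the vorticity equation `FrozenTop.freeze_eq`) -/

/-- `LiouvilleSocket.topIntegrandτ(ebbOf θ) = ofReal(√ν · ν⁻³) · ebbIntegrand` pointwise, for classical solutions on `[0, T)`. -/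
theorem topIntegrandτ_ebbOf_eq {ν T : ℝ} (hν : 0 < ν) (hT : 0 < T) {u : ℝ → LiouvilleSocket.E3 → LiouvilleSocket.E3} {p : ℝ → LiouvilleSocket.E3 → ℝ}
    (hsol : IsClassicalNSSolutionOn (Ico 0 T) ν 0 u p) {t₀ : ℝ} (ht₀ : 0 ≤ t₀) (θ : ℝ) (Λ : ℝ → ℝ)
    (z : ℝ × LiouvilleSocket.E3) :
    LiouvilleSocket.topIntegrandτ T ν t₀ Λ (fun τ v L H K => ebbOf θ τ v L H K) u z =
      ENNReal.ofReal (Real.sqrt ν * (ν ^ 3)⁻¹) * ebbIntegrand T θ t₀ Λ u z := by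
  by_cases hz : z ∈ {z : ℝ × LiouvilleSocket.E3 | z.1 ∈ Ico t₀ T ∧ Λ z.1 < ‖u z.1 z.2‖}
  · have hσ : 0 < T - z.1 := sub_pos.2 hz.1.2
    have hz0 : z.1 ∈ Ico 0 T := ⟨ht₀.trans hz.1.1, hz.1.2⟩
    rw [LiouvilleSocket.topIntegrandτ, ebbIntegrand, indicator_of_mem hz, indicator_of_mem hz,
      ← ENNReal.ofReal_mul (mul_nonneg (Real.sqrt_nonneg ν) (inv_nonneg.2 (pow_nonneg hν.le 3)))]
    congr 1
    have h3 : ContDiff ℝ 3 (u z.1) := (hsol.contDiff_velocity hz0).of_le (by norm_cast)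
    have key := nu_readout_ebbOf hν hσ θ h3 z.2
    rw [FrozenTop.freeze_eq hT hsol hz0 z.2] at key
    have hν3 : ν ^ 3 ≠ 0 := by positivity
    have hI : ebbOf θ (ν * (T - z.1)) (ν⁻¹ • u z.1 z.2) (ν⁻¹ • fderiv ℝ (u z.1) z.2)
        (ν⁻¹ • fderiv ℝ (fderiv ℝ (u z.1)) z.2) (ν⁻¹ • LiouvilleSocket.lapD (u z.1) z.2) =  -- (the τ-tool's `lapD`; defeq)
        (ν ^ 3)⁻¹ * (⟪curl (u z.1) z.2, timeDerivWithin (Ico 0 T) (vorticity u) z.1 z.2⟫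
          - θ * ((T - z.1)⁻¹ * ‖curl (u z.1) z.2‖ ^ 2)) := by
      rw [eq_inv_mul_iff_mul_eq₀ hν3]
      exact key
    have hmax : ∀ P : ℝ, max 0 ((ν ^ 3)⁻¹ * P) = (ν ^ 3)⁻¹ * max 0 P := fun P => by
      rw [mul_max_of_nonneg _ _ (inv_nonneg.2 (pow_nonneg hν.le 3)), mul_zero]
    rw [hI, Real.sqrt_mul hν.le, hmax]
    ring
  · rw [LiouvilleSocket.topIntegrandτ, ebbIntegrand, indicator_of_notMem hz, indicator_of_notMem hz, mul_zero]

/-- `∫ LiouvilleSocket.topIntegrandτ(ebbOf θ) = ν^{-5/2} ∫ ebbIntegrand`. -/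
theorem lintegral_topIntegrandτ_ebbOf_eq {ν T : ℝ} (hν : 0 < ν) (hT : 0 < T) {u : ℝ → LiouvilleSocket.E3 → LiouvilleSocket.E3} {p : ℝ → LiouvilleSocket.E3 → ℝ}
    (hsol : IsClassicalNSSolutionOn (Ico 0 T) ν 0 u p) {t₀ : ℝ} (ht₀ : 0 ≤ t₀) (θ : ℝ) (Λ : ℝ → ℝ) :
    ∫⁻ z, LiouvilleSocket.topIntegrandτ T ν t₀ Λ (fun τ v L H K => ebbOf θ τ v L H K) u z =
      ENNReal.ofReal (Real.sqrt ν * (ν ^ 3)⁻¹) * ∫⁻ z, ebbIntegrand T θ t₀ Λ u z := by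
  rw [← lintegral_const_mul' _ _ ENNReal.ofReal_ne_top]
  exact lintegral_congr fun z => topIntegrandτ_ebbOf_eq hν hT hsol ht₀ θ Λ z

/-- `LiouvilleSocket.topIntegrandτ(flareOf κ) = ofReal(√ν · ν⁻³) · flareIntegrand` pointwise, for classical solutions on `[0, T)`. -/
theorem topIntegrandτ_flareOf_eq {ν T : ℝ} (hν : 0 < ν) (hT : 0 < T) {u : ℝ → LiouvilleSocket.E3 → LiouvilleSocket.E3} {p : ℝ → LiouvilleSocket.E3 → ℝ}
    (hsol : IsClassicalNSSolutionOn (Ico 0 T) ν 0 u p) {t₀ : ℝ} (ht₀ : 0 ≤ t₀) (κ : ℝ) (Λ : ℝ → ℝ)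
    (z : ℝ × LiouvilleSocket.E3) :
    LiouvilleSocket.topIntegrandτ T ν t₀ Λ (fun τ v L H K => flareOf κ τ v L H K) u z =
      ENNReal.ofReal (Real.sqrt ν * (ν ^ 3)⁻¹) * flareIntegrand T κ t₀ Λ u z := by
  by_cases hz : z ∈ {z : ℝ × LiouvilleSocket.E3 | z.1 ∈ Ico t₀ T ∧ Λ z.1 < ‖u z.1 z.2‖}
  · have hσ : 0 < T - z.1 := sub_pos.2 hz.1.2
    have hz0 : z.1 ∈ Ico 0 T := ⟨ht₀.trans hz.1.1, hz.1.2⟩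
    rw [LiouvilleSocket.topIntegrandτ, flareIntegrand, indicator_of_mem hz, indicator_of_mem hz,
      ← ENNReal.ofReal_mul (mul_nonneg (Real.sqrt_nonneg ν) (inv_nonneg.2 (pow_nonneg hν.le 3)))]
    congr 1
    have h3 : ContDiff ℝ 3 (u z.1) := (hsol.contDiff_velocity hz0).of_le (by norm_cast)
    have key := nu_readout_flareOf hν hσ κ h3 z.2
    rw [FrozenTop.freeze_eq hT hsol hz0 z.2] at key
    have hν3 : ν ^ 3 ≠ 0 := by positivity
    have hI : flareOf κ (ν * (T - z.1)) (ν⁻¹ • u z.1 z.2) (ν⁻¹ • fderiv ℝ (u z.1) z.2)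
        (ν⁻¹ • fderiv ℝ (fderiv ℝ (u z.1)) z.2) (ν⁻¹ • LiouvilleSocket.lapD (u z.1) z.2) =  -- (the τ-tool's `lapD`; defeq)
        (ν ^ 3)⁻¹ * (κ * ((T - z.1)⁻¹ * ‖curl (u z.1) z.2‖ ^ 2)
          - ⟪curl (u z.1) z.2, timeDerivWithin (Ico 0 T) (vorticity u) z.1 z.2⟫) := by
      rw [eq_inv_mul_iff_mul_eq₀ hν3]
      exact key
    have hmax : ∀ P : ℝ, max 0 ((ν ^ 3)⁻¹ * P) = (ν ^ 3)⁻¹ * max 0 P := fun P => by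
      rw [mul_max_of_nonneg _ _ (inv_nonneg.2 (pow_nonneg hν.le 3)), mul_zero]
    rw [hI, Real.sqrt_mul hν.le, hmax]
    ring
  · rw [LiouvilleSocket.topIntegrandτ, flareIntegrand, indicator_of_notMem hz, indicator_of_notMem hz, mul_zero]

/-- `∫ LiouvilleSocket.topIntegrandτ(flareOf κ) = ν^{-5/2} ∫ flareIntegrand`. -/
theorem lintegral_topIntegrandτ_flareOf_eq {ν T : ℝ} (hν : 0 < ν) (hT : 0 < T) {u : ℝ → LiouvilleSocket.E3 → LiouvilleSocket.E3}
    {p : ℝ → LiouvilleSocket.E3 → ℝ} (hsol : IsClassicalNSSolutionOn (Ico 0 T) ν 0 u p) {t₀ : ℝ} (ht₀ : 0 ≤ t₀) (κ : ℝ)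
    (Λ : ℝ → ℝ) :
    ∫⁻ z, LiouvilleSocket.topIntegrandτ T ν t₀ Λ (fun τ v L H K => flareOf κ τ v L H K) u z =
      ENNReal.ofReal (Real.sqrt ν * (ν ^ 3)⁻¹) * ∫⁻ z, flareIntegrand T κ t₀ Λ u z := by
  rw [← lintegral_const_mul' _ _ ENNReal.ofReal_ne_top]
  exact lintegral_congr fun z => topIntegrandτ_flareOf_eq hν hT hsol ht₀ κ Λ z

end Summit.NavierStokesRegularity.NavierStokesRegularity.Theorems.ScenarioCensus.EulerianPincer

end
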